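import Summits.BirchSwinnertonDyer.BirchSwinnertonDyer.Theorems.ByReductionTypeAtTwoAdditivePotMultConjATwoAdmissibleCarriers
import Summits.BirchSwinnertonDyer.BirchSwinnertonDyer.Theorems.ByReductionTypeAtTwoAdditivePotMultConjATwoCubicFieldDoor
import HarnessLib

/-!
# C4″ `AdditivePotMultOverKAtTwo` (item stmt-BirchSwinnertonDyer-22618): v11's binder (I1M′) `hAnaMI` VERBATIM from CUBIC-FIELD DATA ONLY —
# GEN 9's `Δ < 0` door (H3M⁻: `μ₂(ℚ(x(T))^cyc) = 0`) composed with GEN 10's two `0 < Δ` doors (H3M⁺: NARROW `μ₂(ℚ(x(T))^cyc) = 0`;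
# or «`μ₂ = 0` for SOME admissible sextic carrier `ℚ(x(T), x)`, `x² ∈ {−1, −2, −Δ, −2Δ}`»)

Cell `bsd-2adic`, seat `bsd-2adic-k4-w3` GEN 10 (explicit unit (309)(7); `--supports 22618`). Two one-line compositions kept in their own
module so that `…ConjATwoTorsionPointFieldDoor` / `…ConjATwoAdmissibleCarriers` do not import `…ConjATwoCubicFieldDoor`. HONEST FRAMING
(D-0036/D-0054): THEOREMS ONLY; both hypotheses of each theorem are OPEN Iwasawa-`μ` statements for explicit non-abelian number fields
(269 complex cubics; 81 totally real cubics / their four CM-sextics); closes nothing; nothing booked; no restate of 19098 / 22618 is asked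
(D-0152); BSD is not proved by any of this.

References: [CoatesSujatha2005] Conj. A, Thm. 3.4; [Kato2004Asterisque] Conj. 12.10 (p. 224); [Iwasawa1973MuInvariants] Thm. 2/3;
[Kida1982JFields] (μ-part, shape); [Lim2017FineSelmer] §3 Thm. 3.5, Lemma 3.2; tree p733022 (GEN 9), GEN 10's two door files.
-/

set_option autoImplicit false
-- the Theorems namespace of this sub repeats the summit name by design (D-0017 nested layout)
set_option linter.dupNamespace false

noncomputable section

open scoped Classical NumberField Polynomial IntermediateField
open NumberField Field Polynomial IntermediateField

namespace Summit.BirchSwinnertonDyer.BirchSwinnertonDyer.Theorems.AddKatoTwo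

open WeierstrassCurve Literature.NumberTheory.EllipticCurves Literature.NumberTheory.EllipticCurves.ZpExtension
  Literature.NumberTheory.GaloisRepresentations Literature.NumberTheory.IwasawaTheory Literature.NumberTheory.NumberFields
  Literature.NumberTheory.EllipticCurves.Rank1Residual

/-- **v11's binder (I1M′) `hAnaMI` VERBATIM from CUBIC-FIELD DATA ONLY, split by the sign of `Δ`:** H3M⁻ = «`μ₂ = 0` for the cyclotomic
`ℤ₂`-extension of `ℚ(x(T))`» on the `Δ < 0` curves (GEN 9's `hμ3`, 269 classes; complex cubic) and H3M⁺ = «NARROW `μ₂ = 0` ((a) ∧ (b)) for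
`ℚ(x(T))`» on the `0 < Δ` curves (81 classes; totally real cubic). GEN 9's `hAnaMI_of_cubicFieldMu_of_posDisc` ∘ GEN 10's
`hAnaMI_posDisc_of_cubicFieldNarrowMu`. So the research `∀`-object (I1M′) of C4″'s upper half reads «Iwasawa `μ₂ = 0`, narrow on the totally
real ones, for the 350 cubic `2`-division fields `ℚ(x(T))`» — OPEN, nothing asserted. [cite: CoatesSujatha2005, Conj. A and Thm. 3.4]
[cite: Kato2004Asterisque, Conj. 12.10 (p. 224)] [cite: Iwasawa1973MuInvariants, Thm. 2 and Thm. 3] [cite: Kida1982JFields, main theorem (μ-part; shape only)] -/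
theorem hAnaMI_of_cubicFieldMu_of_cubicFieldNarrowMu
    (hμ3 : ∀ (W : WeierstrassCurve ℚ) [W.IsElliptic] [W.IsGloballyMinimal], ¬ W.HasCM → W.analyticRank = 0 →
      Addv W 2 → padicValRat 2 W.j < 0 → W.HasIrreducibleModPGaloisRep 2 → W.Δ < 0 →
      ∀ β : AlgebraicClosure ℚ, aeval β W.twoTorsionPolynomial.toPoly = 0 →
      ∀ κP : ZpExtension ↥(IntermediateField.adjoin ℚ ({β} : Set (AlgebraicClosure ℚ))) 2,
        κP.IsCyclotomic → ClassicalMuVanishes κP)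
    (hμ3p : ∀ (W : WeierstrassCurve ℚ) [W.IsElliptic] [W.IsGloballyMinimal], ¬ W.HasCM → W.analyticRank = 0 →
      Addv W 2 → padicValRat 2 W.j < 0 → W.HasIrreducibleModPGaloisRep 2 → 0 < W.Δ →
      ∀ β : AlgebraicClosure ℚ, aeval β W.twoTorsionPolynomial.toPoly = 0 →
      (∀ κP : ZpExtension ↥(IntermediateField.adjoin ℚ ({β} : Set (AlgebraicClosure ℚ))) 2,
          κP.IsCyclotomic → ClassicalMuVanishes κP) ∧
      ∃ D : ℕ, ∀ κP : ZpExtension ↥(IntermediateField.adjoin ℚ ({β} : Set (AlgebraicClosure ℚ))) 2, κP.IsCyclotomic → ∀ n : ℕ,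
        ∀ [NumberField ↥(κP.layer n)],
        padicValNat 2 (narrowClassNumber ↥(κP.layer n)) ≤ padicValNat 2 (classNumber ↥(κP.layer n)) + D) :
    ∀ (W : WeierstrassCurve ℚ) [W.IsElliptic] [W.IsGloballyMinimal], ¬ W.HasCM → W.analyticRank = 0 →
      Addv W 2 → padicValRat 2 W.j < 0 → W.HasIrreducibleModPGaloisRep 2 → ¬ IsAbelianGalois ℚ (W.divisionField 2) →
      ∀ (κ : ZpExtension ℚ 2), κ.IsCyclotomic →
        ∃ (γ : Field.absoluteGaloisGroup ℚ) (D : W.FineSelmerDualData κ γ),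
          Module.Finite ℤ_[2] (RestrictScalars ℤ_[2] (IwasawaAlgebra 2) D.X) :=
  hAnaMI_of_cubicFieldMu_of_posDisc hμ3 (hAnaMI_posDisc_of_cubicFieldNarrowMu hμ3p)

/-- **v11's binder (I1M′) `hAnaMI` VERBATIM from GEN 9's H3M⁻ (`μ₂(ℚ(x(T))^cyc) = 0` on `Δ < 0`) and «`μ₂ = 0` for SOME admissible sextic
carrier `ℚ(x(T), x)`, `x² ∈ {−1, −2, −Δ, −2Δ}`» on `0 < Δ`.** GEN 9's `hAnaMI_of_cubicFieldMu_of_posDisc` ∘ GEN 10's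
`hAnaMI_posDisc_of_exists_admissibleCarrierMu`. OPEN inputs, nothing asserted. [cite: CoatesSujatha2005, Conj. A and Thm. 3.4]
[cite: Kato2004Asterisque, Conj. 12.10 (p. 224)] [cite: Lim2017FineSelmer, §3 Thm. 3.5 and Lemma 3.2] -/
theorem hAnaMI_of_cubicFieldMu_of_exists_admissibleCarrierMu
    (hμ3 : ∀ (W : WeierstrassCurve ℚ) [W.IsElliptic] [W.IsGloballyMinimal], ¬ W.HasCM → W.analyticRank = 0 →
      Addv W 2 → padicValRat 2 W.j < 0 → W.HasIrreducibleModPGaloisRep 2 → W.Δ < 0 →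
      ∀ β : AlgebraicClosure ℚ, aeval β W.twoTorsionPolynomial.toPoly = 0 →
      ∀ κP : ZpExtension ↥(IntermediateField.adjoin ℚ ({β} : Set (AlgebraicClosure ℚ))) 2,
        κP.IsCyclotomic → ClassicalMuVanishes κP)
    (hμx : ∀ (W : WeierstrassCurve ℚ) [W.IsElliptic] [W.IsGloballyMinimal], ¬ W.HasCM → W.analyticRank = 0 →
      Addv W 2 → padicValRat 2 W.j < 0 → W.HasIrreducibleModPGaloisRep 2 → 0 < W.Δ →
      ∀ β : AlgebraicClosure ℚ, aeval β W.twoTorsionPolynomial.toPoly = 0 →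
      ∃ x : AlgebraicClosure ℚ, (x ^ 2 = -1 ∨ x ^ 2 = -2 ∨ x ^ 2 = -algebraMap ℚ (AlgebraicClosure ℚ) W.Δ ∨
          x ^ 2 = -2 * algebraMap ℚ (AlgebraicClosure ℚ) W.Δ) ∧
        ∀ κF : ZpExtension ↥(IntermediateField.adjoin ℚ ({β} : Set (AlgebraicClosure ℚ)) ⊔
            IntermediateField.adjoin ℚ ({x} : Set (AlgebraicClosure ℚ))) 2, κF.IsCyclotomic → ClassicalMuVanishes κF) :
    ∀ (W : WeierstrassCurve ℚ) [W.IsElliptic] [W.IsGloballyMinimal], ¬ W.HasCM → W.analyticRank = 0 →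
      Addv W 2 → padicValRat 2 W.j < 0 → W.HasIrreducibleModPGaloisRep 2 → ¬ IsAbelianGalois ℚ (W.divisionField 2) →
      ∀ (κ : ZpExtension ℚ 2), κ.IsCyclotomic →
        ∃ (γ : Field.absoluteGaloisGroup ℚ) (D : W.FineSelmerDualData κ γ),
          Module.Finite ℤ_[2] (RestrictScalars ℤ_[2] (IwasawaAlgebra 2) D.X) :=
  hAnaMI_of_cubicFieldMu_of_posDisc hμ3 (hAnaMI_posDisc_of_exists_admissibleCarrierMu hμx)

end Summit.BirchSwinnertonDyer.BirchSwinnertonDyer.Theorems.AddKatoTwo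

end
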